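import Literature.IUT.HodgeTheaters.ProfiniteCompletionLifting
import Literature.IUT.HodgeTheaters.DiscreteProfiniteCompletionsProofs
import Mathlib.Topology.Instances.ZMod
import Mathlib.GroupTheory.NoncommCoprod
import HarnessLib

/-!
# [IUTchI] Lemma 2.7 (v), FREE CASE: `T̂ ≅ ℤ̂` with a retraction `Ĝ ↠ ℤ̂` is normally terminal in `Ĝ`

Mochizuki, *Inter-universal Teichmüller theory I*, kurims manuscript (May 2020), §2, Lemma 2.7 (v),
statement p. 57: "Let `T̂ ⊆ Ĝ` be a closed subgroup such that there exists a continuous surjection of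
topological groups `Ĝ ↠ ℤ̂` that induces an isomorphism `T̂ ⥲ ℤ̂`.  Then `T̂` is normally terminal in `Ĝ`",
proof p. 59 [cite: Mochizuki2012, Lem 2.7(v) p.59] (D-0012 claim key, status disputed — the content here
is plain profinite group theory and takes no side).  The named statement is
`FreeOrSurface.zHatQuotientNormallyTerminal` (abc-iut-L5-t1, `DiscreteProfiniteConjugates.lean`), for `G`
free of finite rank OR an orientable surface group.  This file PROVES it for `G` FREE
(`zHatQuotientNormallyTerminal_of_isFreeOfFiniteRank`; in fact for `IsFreeGroup G` of any rank, and
without using that `T̂` is closed or that `Ĝ → ℤ̂` is surjective), by the printed route with the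
cohomological-dimension sentence replaced by the elementary lifting/obstruction pair of
`ProfiniteCompletionLifting.lean`:

* p. 59, "By considering the surjection `Ĝ ↠ ℤ̂` … `N_Ĝ(T̂) = Z_Ĝ(T̂)`" — abc-iut-L5-t9's
  `normalizer_le_centralizer_of_injOn` (`DiscreteProfiniteCompletionsProofs.lean`);
* p. 59, "If `Z_Ĝ(T̂) ≠ T̂`, then … for some prime number `l`, there exists a closed [abelian] subgroup
  `T̂₁ ⊆ Z_Ĝ(T̂)` … [with] a continuous surjection `ℤ_l × ℤ_l ↠ T̂₁` whose kernel lies in `l · (ℤ_l × ℤ_l)`" —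
  `eq_one_of_commute_of_zHat`: for `z ∈ Z_Ĝ(T̂)` write `z = t · k`, `t ∈ T̂`, `k ∈ Ker(Ĝ → ℤ̂)` commuting with
  a topological generator `τ` of `T̂`; if `k ≠ 1`, a finite quotient `Ĝ → G/N₀ × ℤ/n` exhibits a prime `p`
  and an open subgroup `U ∋ τ, k` with a continuous `U → (ℤ/p)²` mapping `τ, k` to a basis;
* p. 59, "the `l`-cohomological dimension of `T̂₁` is `≥ 2` … [but] is `1`, a contradiction" —
  `exists_lift_of_surjective` + `wreath_not_commute` (part IV): commuting `τ, k` would lift to commuting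
  lifts of the basis in `C_p ≀ C_p`, which do not exist.  Hence `Z_Ĝ(T̂) ⊆ T̂`
  (`centralizer_le_of_zHat`), and `N_Ĝ(T̂) = T̂`.

The orientable-surface-group half of the named statement is NOT treated here (abc-iut-L5-d1's lane).
Theorems only.
-/

namespace Literature.IUT.HodgeTheaters

open CategoryTheory ProfiniteGrp ProfiniteGrp.ProfiniteCompletion Topology Multiplicative

universe u

namespace ProfiniteCompletion

variable {G : Type u} [Group G]

/-- A nontrivial element of `Ĝ` has a nontrivial component at some level. [cite: Mochizuki2012, Lem 2.7(v) p.59] -/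
theorem exists_val_ne_one {k : profiniteCompletion G} (hk : k ≠ 1) :
    ∃ N : FiniteIndexNormalSubgroup G, k.val N ≠ 1 := by
  by_contra h
  push Not at h
  exact hk (ProfiniteGrp.limit_ext _ _ _ fun N => by rw [h N]; rfl)

/-- **Core of Lemma 2.7 (v), free case.**  Let `G` be a free group, `φ : Ĝ → ℤ̂` a continuous homomorphism,
`τ ∈ Ĝ` an element mapped by `φ` to the topological generator `1 ∈ ℤ̂`, and `k ∈ Ker φ` an element
COMMUTING with `τ`.  Then `k = 1`.  (If not: at a finite level `G/N₀` some power `k₁` of `k` has prime order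
`p`; with `n = |G/N₀|` the continuous `Ψ = (·|_{N₀}, φ mod n) : Ĝ → G/N₀ × ℤ/n` maps `τ, k₁` to commuting
`c₁, c₂` with `⟨c₁, c₂⟩ ≅ ℤ/n × ℤ/p`, `p ∣ n`; on the open subgroup `U = Ψ⁻¹⟨c₁, c₂⟩` reduction mod `p`
gives a continuous `U → (ℤ/p)²` with `τ ↦ (1,0)`, `k₁ ↦ (0,1)`; by the lifting lemma it lifts to
`C_p ≀ C_p`, where the images of the commuting `τ, k₁` would be commuting lifts of the basis — impossible,
`wreath_not_commute`.)  This is the sentence "there exists a closed [abelian] subgroup `T̂₁ ⊆ Z_Ĝ(T̂)` …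
`ℤ_l × ℤ_l ↠ T̂₁` … a contradiction" of p. 59, made elementary. [cite: Mochizuki2012, Lem 2.7(v) p.59] -/
theorem eq_one_of_commute_of_zHat [IsFreeGroup G] (φ : profiniteCompletion G →* ZHat)
    (hφ : Continuous φ) {τ k : profiniteCompletion G} (hc : τ * k = k * τ)
    (hτ : φ τ = toCompletion (Multiplicative ℤ) (ofAdd 1)) (hk : φ k = 1) : k = 1 := by
  classical
  by_contra hk1
  obtain ⟨N₀, hN₀⟩ := exists_val_ne_one hk1
  -- the projection `π : Ĝ → G/N₀`
  let π : profiniteCompletion G →* G ⧸ N₀.toSubgroup :=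
    MonoidHom.mk' (fun x => (x.val N₀ : G ⧸ N₀.toSubgroup)) fun _ _ => rfl
  have hπk : π k ≠ 1 := hN₀
  -- a prime `p` and a power `k₁` of `k` whose image has order `p`
  have hm0 : orderOf (π k) ≠ 0 := (orderOf_pos (π k)).ne'
  have hm1 : orderOf (π k) ≠ 1 := fun h => hπk (orderOf_eq_one_iff.mp h)
  obtain ⟨p, hpdef⟩ : ∃ p, p = (orderOf (π k)).minFac := ⟨_, rfl⟩
  haveI hp : Fact p.Prime := ⟨hpdef ▸ Nat.minFac_prime hm1⟩
  have hpm : p ∣ orderOf (π k) := hpdef ▸ Nat.minFac_dvd _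
  obtain ⟨k₁, hk₁def⟩ : ∃ k₁, k₁ = k ^ (orderOf (π k) / p) := ⟨_, rfl⟩
  have hk₁ord : orderOf (π k₁) = p := by
    rw [hk₁def, map_pow]
    exact orderOf_pow_orderOf_div hm0 hpm
  have hc₁ : τ * k₁ = k₁ * τ := by
    rw [hk₁def]
    exact (Commute.pow_right hc _).eq
  have hk₁φ : φ k₁ = 1 := by rw [hk₁def, map_pow, hk, one_pow]
  -- `n = |G/N₀|`, so `p ∣ n` and `π(x)^n = 1`
  obtain ⟨n, hndef⟩ : ∃ n, n = Nat.card (G ⧸ N₀.toSubgroup) := ⟨_, rfl⟩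
  haveI : NeZero n := ⟨hndef ▸ Nat.card_pos.ne'⟩
  have hpn : p ∣ n := by rw [← hk₁ord, hndef]; exact orderOf_dvd_natCard (π k₁)
  have hπn : ∀ x, (π x) ^ n = 1 := fun x => by rw [hndef]; exact pow_card_eq_one'
  -- reduction `ρ : ℤ̂ → ℤ/n`
  obtain ⟨ρ, hρη, -, hρc⟩ :=
    exists_lift_of_finite (G := Multiplicative ℤ) ((Int.castAddHom (ZMod n)).toMultiplicative)
  have hρc' : Continuous ρ := hρc
  -- `Ψ = (π, ρ ∘ φ)`
  let Ψ : profiniteCompletion G →* (G ⧸ N₀.toSubgroup) × Multiplicative (ZMod n) :=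
    π.prod (ρ.comp φ)
  have hΨτ : Ψ τ = (π τ, ofAdd 1) := by
    change (π τ, ρ (φ τ)) = _
    rw [hτ, hρη]
    simp
  have hΨk : Ψ k₁ = (π k₁, 1) := by
    change (π k₁, ρ (φ k₁)) = _
    rw [hk₁φ, map_one]
  -- a level `N` with `{x | x.val N = 1} ⊆ Ker Ψ`
  obtain ⟨N₃, hN₃⟩ : ∃ N₃ : FiniteIndexNormalSubgroup G,
      ∀ x : profiniteCompletion G, x.val N₃ = 1 → ρ (φ x) = 1 := by
    have ho : IsOpen ((fun x => ρ (φ x)) ⁻¹' {1}) := (isOpen_discrete _).preimage (hρc'.comp hφ)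
    have h1 : (1 : profiniteCompletion G) ∈ (fun x => ρ (φ x)) ⁻¹' {1} := by
      rw [Set.mem_preimage, map_one, map_one]
      exact Set.mem_singleton 1
    exact exists_val_eq_one_subset_of_isOpen ho h1
  let N : FiniteIndexNormalSubgroup G := N₀ ⊓ N₃
  have hNΨ : ∀ x : profiniteCompletion G, x.val N = 1 → Ψ x = 1 := by
    intro x hx
    have h0 : x.val N₀ = 1 := val_eq_one_of_le x inf_le_left hx
    have h3 : ρ (φ x) = 1 := hN₃ x (val_eq_one_of_le x inf_le_right hx)
    exact Prod.ext h0 h3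
  -- the abelian image `C = ⟨Ψ τ, Ψ k₁⟩` as the range of `gC : ℤ × ℤ → G/N₀ × ℤ/n`
  have hcomm : Commute (Ψ τ) (Ψ k₁) := by
    change Ψ τ * Ψ k₁ = Ψ k₁ * Ψ τ
    rw [← map_mul, hc₁, map_mul]
  let gC : Multiplicative ℤ × Multiplicative ℤ →* (G ⧸ N₀.toSubgroup) × Multiplicative (ZMod n) :=
    MonoidHom.noncommCoprod (zpowersHom _ (Ψ τ)) (zpowersHom _ (Ψ k₁))
      fun a b => (hcomm.zpow_left a.toAdd).zpow_right b.toAdd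
  have hgC : ∀ a b : Multiplicative ℤ, gC (a, b) = Ψ τ ^ a.toAdd * Ψ k₁ ^ b.toAdd := fun a b => rfl
  let C := gC.range
  let U : Subgroup (profiniteCompletion G) := C.comap Ψ
  have hτU : τ ∈ U := ⟨(ofAdd 1, 1), by rw [hgC]; simp⟩
  have hkU : k₁ ∈ U := ⟨(1, ofAdd 1), by rw [hgC]; simp⟩
  -- the kernel of `gC` dies under reduction mod `p`
  let red : Multiplicative ℤ →* Multiplicative (ZMod p) := (Int.castAddHom (ZMod p)).toMultiplicative
  have hred : ∀ a : Multiplicative ℤ, (p : ℤ) ∣ a.toAdd → red a = 1 := by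
    intro a ha
    change ofAdd ((a.toAdd : ZMod p)) = 1
    rw [(ZMod.intCast_zmod_eq_zero_iff_dvd a.toAdd p).mpr ha, ofAdd_zero]
  let βt : Multiplicative ℤ × Multiplicative ℤ →* Multiplicative (ZMod p) × Multiplicative (ZMod p) :=
    red.prodMap red
  have hτ2 : (Ψ τ).2 = ofAdd 1 := by rw [hΨτ]
  have hk2 : (Ψ k₁).2 = 1 := by rw [hΨk]
  have hker : gC.rangeRestrict.ker ≤ βt.ker := by
    rw [MonoidHom.ker_rangeRestrict]
    rintro ⟨a, b⟩ hab
    rw [MonoidHom.mem_ker, hgC] at hab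
    -- second coordinate: `n ∣ a`
    have h2 := congrArg (MonoidHom.snd (G ⧸ N₀.toSubgroup) (Multiplicative (ZMod n))) hab
    rw [map_mul, map_zpow, map_zpow, map_one, MonoidHom.coe_snd, hτ2, hk2, one_zpow, mul_one,
      ← ofAdd_zsmul, zsmul_one, ofAdd_eq_one, ZMod.intCast_zmod_eq_zero_iff_dvd] at h2
    -- first coordinate: `p ∣ b`
    have h1 := congrArg (MonoidHom.fst (G ⧸ N₀.toSubgroup) (Multiplicative (ZMod n))) hab
    rw [map_mul, map_zpow, map_zpow, map_one, MonoidHom.coe_fst] at h1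
    change π τ ^ a.toAdd * π k₁ ^ b.toAdd = 1 at h1
    obtain ⟨c, hc⟩ := h2
    rw [hc, zpow_mul, zpow_natCast, hπn, one_zpow, one_mul, ← orderOf_dvd_iff_zpow_eq_one,
      hk₁ord] at h1
    have ha : (p : ℤ) ∣ a.toAdd := (Int.natCast_dvd_natCast.mpr hpn).trans ⟨c, hc⟩
    rw [MonoidHom.mem_ker]
    exact Prod.ext (hred a ha) (hred b h1)
  let β : C →* Multiplicative (ZMod p) × Multiplicative (ZMod p) :=
    gC.rangeRestrict.liftOfSurjective gC.rangeRestrict_surjective ⟨βt, hker⟩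
  have hβ : ∀ z, β (gC.rangeRestrict z) = βt z := fun z =>
    MonoidHom.liftOfRightInverse_comp_apply _ _ _ _ z
  -- `ψ : U → (ℤ/p)²`, `τ ↦ (1, 0)`, `k₁ ↦ (0, 1)` (written multiplicatively)
  let ΨU : U →* C := (Ψ.comp U.subtype).codRestrict C fun x => x.2
  let ψ : U →* Multiplicative (ZMod p) × Multiplicative (ZMod p) := β.comp ΨU
  have hΨU : ∀ (x : profiniteCompletion G) (hx : x ∈ U) (z : Multiplicative ℤ × Multiplicative ℤ),
      gC z = Ψ x → ΨU ⟨x, hx⟩ = gC.rangeRestrict z := fun x hx z hz => Subtype.ext hz.symm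
  have hred1 : red (ofAdd 1) = ofAdd 1 := by
    change ofAdd (((1 : ℤ) : ZMod p)) = ofAdd 1
    rw [Int.cast_one]
  have hψτ : ψ ⟨τ, hτU⟩ = (ofAdd 1, 1) := by
    change β (ΨU ⟨τ, hτU⟩) = _
    rw [hΨU τ hτU (ofAdd 1, 1) (by rw [hgC]; simp), hβ]
    change (red (ofAdd 1), red 1) = _
    rw [map_one red, hred1]
  have hψk : ψ ⟨k₁, hkU⟩ = (1, ofAdd 1) := by
    change β (ΨU ⟨k₁, hkU⟩) = _
    rw [hΨU k₁ hkU (1, ofAdd 1) (by rw [hgC]; simp), hβ]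
    change (red 1, red (ofAdd 1)) = _
    rw [map_one red, hred1]
  -- hypotheses of the lifting lemma: `{x | x.val N = 1} ⊆ U ∩ Ker ψ`
  have hU1 : ∃ N₁ : FiniteIndexNormalSubgroup G,
      ∀ x : profiniteCompletion G, x.val N₁ = 1 → x ∈ U :=
    ⟨N, fun x hx => by
      change Ψ x ∈ C
      rw [hNΨ x hx]
      exact C.one_mem⟩
  have hψ1 : ∃ N₂ : FiniteIndexNormalSubgroup G,
      ∀ (x : profiniteCompletion G) (hx : x ∈ U), x.val N₂ = 1 → ψ ⟨x, hx⟩ = 1 :=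
    ⟨N, fun x hx hxN => by
      have h1 : ΨU ⟨x, hx⟩ = 1 := Subtype.ext (hNΨ x hxN)
      change β (ΨU ⟨x, hx⟩) = 1
      rw [h1, map_one]⟩
  -- lift to the wreath product `C_p ≀ C_p` and conclude
  obtain ⟨σ, hσ⟩ := exists_wreath_prod_hom p
  obtain ⟨θ, hθ⟩ := exists_lift_of_surjective U hU1 (RegularWreathProduct.rightHom.prod σ)
    (wreath_pair_surjective p σ hσ) ψ hψ1
  have hxy : θ ⟨τ, hτU⟩ * θ ⟨k₁, hkU⟩ = θ ⟨k₁, hkU⟩ * θ ⟨τ, hτU⟩ := by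
    rw [← map_mul, ← map_mul]
    exact congrArg θ (Subtype.ext hc₁)
  have hθτ := hθ ⟨τ, hτU⟩
  have hθk := hθ ⟨k₁, hkU⟩
  rw [hψτ, MonoidHom.prod_apply, Prod.mk.injEq] at hθτ
  rw [hψk, MonoidHom.prod_apply, Prod.mk.injEq] at hθk
  exact wreath_not_commute p (θ ⟨τ, hτU⟩) (θ ⟨k₁, hkU⟩) hθτ.1 hθk.1 ((hσ _).symm.trans hθk.2) hxy

/-- **`Z_Ĝ(T̂) ⊆ T̂`** (p. 59) for `G` free: if `φ : Ĝ → ℤ̂` is a continuous homomorphism that is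
bijective on the subgroup `T̂ ⊆ Ĝ`, then the centralizer of `T̂` in `Ĝ` is contained in `T̂`.  (`T̂` is
abelian since `φ` is injective on it; for `z ∈ Z_Ĝ(T̂)` pick `t ∈ T̂` with `φ t = φ z` and apply
`eq_one_of_commute_of_zHat` to `k = t⁻¹ z` and a topological generator `τ ∈ T̂`.)  Neither closedness of
`T̂` nor surjectivity of `φ` on `Ĝ` is needed. [cite: Mochizuki2012, Lem 2.7(v) p.59] -/
theorem centralizer_le_of_zHat [IsFreeGroup G] (T : Subgroup (profiniteCompletion G))
    (φ : profiniteCompletion G →* ZHat) (hφ : Continuous φ)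
    (hT : Function.Bijective (φ.comp T.subtype)) :
    Subgroup.centralizer (T : Set (profiniteCompletion G)) ≤ T := by
  intro z hz
  rw [Subgroup.mem_centralizer_iff] at hz
  -- `T̂` is abelian
  have hTab : ∀ a ∈ T, ∀ b ∈ T, a * b = b * a := fun a ha b hb => by
    have h := hT.1 (a₁ := ⟨a, ha⟩ * ⟨b, hb⟩) (a₂ := ⟨b, hb⟩ * ⟨a, ha⟩)
      (by rw [map_mul, map_mul]; exact ZHat.mul_comm _ _)
    exact congrArg Subtype.val h
  obtain ⟨⟨t, ht⟩, htz⟩ := hT.2 (φ z)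
  obtain ⟨⟨τ, hτ⟩, hτ1⟩ := hT.2 (toCompletion (Multiplicative ℤ) (ofAdd 1))
  change φ t = φ z at htz
  change φ τ = _ at hτ1
  have hk1 : φ (t⁻¹ * z) = 1 := by rw [map_mul, map_inv, htz, inv_mul_cancel]
  have hc : τ * (t⁻¹ * z) = t⁻¹ * z * τ := by
    have h1 : τ * t⁻¹ = t⁻¹ * τ := hTab τ hτ t⁻¹ (T.inv_mem ht)
    have h2 : τ * z = z * τ := hz τ hτ
    calc τ * (t⁻¹ * z) = τ * t⁻¹ * z := (mul_assoc _ _ _).symm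
      _ = t⁻¹ * (τ * z) := by rw [h1, mul_assoc]
      _ = t⁻¹ * z * τ := by rw [h2, mul_assoc]
  have hk := eq_one_of_commute_of_zHat φ hφ hc hτ1 hk1
  rw [← inv_mul_eq_one.mp hk]
  exact ht

end ProfiniteCompletion

/-! ### Lemma 2.7 (v), free case -/

namespace FreeOrSurface

/-- **Lemma 2.7 (v) for `G` free of finite rank** (statement p. 57, proof p. 59): if `T̂ ⊆ Ĝ` is a
closed subgroup and `Ĝ ↠ ℤ̂` a continuous surjection inducing an isomorphism `T̂ ⥲ ℤ̂`, then `T̂` is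
normally terminal in `Ĝ`, `N_Ĝ(T̂) = T̂`.  Assembled from `N_Ĝ(T̂) ⊆ Z_Ĝ(T̂)` (abc-iut-L5-t9,
`normalizer_le_centralizer_of_injOn`) and `Z_Ĝ(T̂) ⊆ T̂` (`ProfiniteCompletion.centralizer_le_of_zHat`).
This is the free half of the named statement `FreeOrSurface.zHatQuotientNormallyTerminal`; the
orientable-surface-group half is not treated here. [cite: Mochizuki2012, Lem 2.7(v) p.59] -/
theorem zHatQuotientNormallyTerminal_of_isFreeOfFiniteRank :
    ∀ (G : Type u) [Group G], IsFreeOfFiniteRank G →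
      ∀ (T : Subgroup (profiniteCompletion G)), IsClosed (T : Set (profiniteCompletion G)) →
        (∃ φ : profiniteCompletion G →* ZHat, Continuous φ ∧ Function.Surjective φ ∧
          Function.Bijective (φ.comp T.subtype)) →
        Subgroup.normalizer (T : Set (profiniteCompletion G)) = T := by
  intro G _ hG T _ hφ
  obtain ⟨n, ⟨e⟩⟩ := hG
  haveI : IsFreeGroup G := IsFreeGroup.ofMulEquiv e.symm
  obtain ⟨φ, hφc, -, hφb⟩ := hφ
  have hinj : Set.InjOn φ T := by
    intro a ha b hb hab
    have := hφb.1 (a₁ := ⟨a, ha⟩) (a₂ := ⟨b, hb⟩) (by simpa using hab)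
    exact congrArg Subtype.val this
  apply le_antisymm
  · exact (normalizer_le_centralizer_of_injOn ZHat.mul_comm φ T hinj).trans
      (ProfiniteCompletion.centralizer_le_of_zHat T φ hφc hφb)
  · exact Subgroup.le_normalizer

/-- Lemma 2.7 (v), free case, for a free group of ANY rank (`IsFreeGroup G`), in explicit-argument form.
[cite: Mochizuki2012, Lem 2.7(v) p.59] -/
theorem normalizer_eq_of_zHat_of_isFreeGroup (G : Type u) [Group G] [IsFreeGroup G]
    (T : Subgroup (profiniteCompletion G)) (φ : profiniteCompletion G →* ZHat) (hφ : Continuous φ)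
    (hT : Function.Bijective (φ.comp T.subtype)) :
    Subgroup.normalizer (T : Set (profiniteCompletion G)) = T := by
  have hinj : Set.InjOn φ T := by
    intro a ha b hb hab
    have := hT.1 (a₁ := ⟨a, ha⟩) (a₂ := ⟨b, hb⟩) (by simpa using hab)
    exact congrArg Subtype.val this
  apply le_antisymm
  · exact (normalizer_le_centralizer_of_injOn ZHat.mul_comm φ T hinj).trans
      (ProfiniteCompletion.centralizer_le_of_zHat T φ hφ hT)
  · exact Subgroup.le_normalizer

end FreeOrSurface

end Literature.IUT.HodgeTheaters
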